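import Literature.Geometry.Lorentzian.BogovskiiVectorRegularity
import Mathlib.Analysis.Calculus.ContDiff.FiniteDimension
import HarnessLib

/-!
# The Bogovskiĭ-type operators of Mao–Oh–Tao are smooth-in / smooth-out

(namespace `Literature.Geometry.Lorentzian.MaoOhTao`; companion of `BogovskiiOperatorRegularity.lean` and
`BogovskiiVectorRegularity.lean`.)

Mao–Oh–Tao (arXiv:2308.13031), Lemma 2.3: the building blocks of the double-divergence inverse `S` and of the
symmetric anti-divergence `T` on a set star-shaped with respect to a ball are the integral operators
`(S_η f)^{ij}(x) = ∫ w_y zᵢzⱼ/|z|³|_{z=x−y} f(y) dy` and `(SV_η f)^{a}(x) = ∫ w_y z_a/|z|³|_{z=x−y} f(y) dy`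
(`w_y` = `bogovskiiWeight η y`). The tree proves that they are `C¹` for `η, f ∈ C¹_c` with the derivative formulas
`∂ₘ(S_η f) = S_{∂ₘη} f + S_η(∂ₘ f)`, `∂ₘ(SV_η f) = SV_{∂ₘη} f + SV_η(∂ₘ f)` (`pd_bogovskiiOperator`,
`pd_bogovskiiVOperator`). This file iterates them:

* `contDiff_bogovskiiOperator`, `contDiff_bogovskiiVOperator` — **`S_η f`, `SV_η f ∈ C^n` for `η ∈ C^n` vanishing off a
  ball and `f ∈ C^n_c`**, every `n : ℕ` (induction: `C^{n+1} ⟸` differentiable with all directional derivatives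
  `Σₘ vₘ (op_{∂ₘη} f + op_η ∂ₘf) ∈ C^n`);
* `contDiff_infty_bogovskiiOperator`, `contDiff_infty_bogovskiiVOperator` — hence `C^∞` for `C^∞` data.

Consequence for users (route PointSink of the anomalous-dissipation summit, stub `stub_freeSpaceSinkCompletion`,
residue R2 of its work file): on star-shaped cells the weak symmetric anti-divergence
`T F = ½(SV + SVᵀ) + ½∂ₘ(SK + …) − ∂ₖSK` of `BogovskiiVectorOperator.lean` is a smooth FUNCTION when `F ∈ C_c^∞`;
what is still missing for a smooth compactly supported anti-divergence on (thin) shells is the gluing recursion of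
`BogovskiiGluingVec.lean` re-run with smooth partitions of unity and a thin-shell star cover (not done here).

Everything is proved; no definitions, no named facts.

## References

* Y. Mao, S.-J. Oh, T. Tao, arXiv:2308.13031 (2023), Lemma 2.3 and its proof, p. 8 (key `MaoOhTao2023`).
* M. Geißert, H. Heck, M. Hieber, in: *Partial Differential Equations and Functional Analysis* (Birkhäuser, 2006),
  Thm 2.5 (`B : C_c^∞(Ω) → C_c^∞(Ω)ⁿ` for the classical Bogovskiĭ operator).
-/

noncomputable section

open scoped RealInnerProductSpace Topology ContDiff
open Filter MeasureTheory Set Metric Function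

namespace Literature.Geometry.Lorentzian

namespace MaoOhTao

/-- Expansion of a derivative along a vector in the standard basis: `Dg(x) v = Σₘ vₘ ∂ₘg(x)`. [folklore] -/
theorem fderiv_apply_eq_sum_pd (g : E3 → ℝ) (x v : E3) : fderiv ℝ g x v = ∑ m, v m * pd m g x := by
  conv_lhs => rw [← (EuclideanSpace.basisFun (Fin 3) ℝ).sum_repr v]
  simp only [map_sum, map_smul, EuclideanSpace.basisFun_repr, EuclideanSpace.basisFun_apply, smul_eq_mul, pd, e]

/-- **`S_η f ∈ C^n`** for `η ∈ C^n` vanishing off `B̄_R` and `f ∈ C^n_c`, every `n : ℕ` (induction on `n` with the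
derivative formula `pd_bogovskiiOperator`). [cite: MaoOhTao2023, Lemma 2.3] -/
theorem contDiff_bogovskiiOperator (n : ℕ) :
    ∀ {η f : E3 → ℝ} {R : ℝ}, ContDiff ℝ n η → (∀ z : E3, R < ‖z‖ → η z = 0) → ContDiff ℝ n f →
      HasCompactSupport f → ∀ i j : Fin 3,
        ContDiff ℝ n fun x : E3 ↦ ∫ y : E3, bogovskiiWeight η y ‖x - y‖ (‖x - y‖⁻¹ • (x - y)) *
          ((x - y) i * ((x - y) j * (‖x - y‖ ^ 3)⁻¹)) * f y := by
  induction n with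
  | zero =>
    intro η f R hη hR hf hfc i j
    rw [Nat.cast_zero, contDiff_zero]
    exact continuous_bogovskiiOperator hη.continuous hR hf.continuous hfc i j
  | succ n ih =>
    intro η f R hη hR hf hfc i j
    have hη1 : ContDiff ℝ 1 η := hη.of_le (by exact_mod_cast Nat.le_add_left 1 n)
    have hf1 : ContDiff ℝ 1 f := hf.of_le (by exact_mod_cast Nat.le_add_left 1 n)
    have hηn : ∀ m, ContDiff ℝ n (pd m η) := fun m ↦ contDiff_pd (by exact_mod_cast hη) m
    have hfn : ∀ m, ContDiff ℝ n (pd m f) := fun m ↦ contDiff_pd (by exact_mod_cast hf) m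
    have hηR : ∀ m (z : E3), R < ‖z‖ → pd m η z = 0 := fun m z hz ↦ pd_eq_zero_of_norm_lt hR m z hz
    have hfcn : ∀ m, HasCompactSupport (pd m f) := fun m ↦ hasCompactSupport_pd hfc m
    have hηn' : ContDiff ℝ n η := hη.of_le (by exact_mod_cast Nat.le_succ n)
    have hfn' : ContDiff ℝ n f := hf.of_le (by exact_mod_cast Nat.le_succ n)
    rw [show ((↑(n + 1) : ℕ∞ω)) = (n : ℕ∞ω) + 1 by push_cast; rfl, contDiff_succ_iff_fderiv_apply]
    refine ⟨differentiable_bogovskiiOperator hη1 hR hf1 hfc i j, fun h ↦ by simp at h, fun v ↦ ?_⟩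
    · have hexp : (fun x : E3 ↦ fderiv ℝ (fun x : E3 ↦ ∫ y : E3, bogovskiiWeight η y ‖x - y‖
          (‖x - y‖⁻¹ • (x - y)) * ((x - y) i * ((x - y) j * (‖x - y‖ ^ 3)⁻¹)) * f y) x v) =
          fun x ↦ ∑ m, v m * ((∫ y : E3, bogovskiiWeight (pd m η) y ‖x - y‖ (‖x - y‖⁻¹ • (x - y)) *
              ((x - y) i * ((x - y) j * (‖x - y‖ ^ 3)⁻¹)) * f y) +
            ∫ y : E3, bogovskiiWeight η y ‖x - y‖ (‖x - y‖⁻¹ • (x - y)) *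
              ((x - y) i * ((x - y) j * (‖x - y‖ ^ 3)⁻¹)) * pd m f y) := by
        funext x
        rw [fderiv_apply_eq_sum_pd]
        refine Finset.sum_congr rfl fun m _ ↦ ?_
        rw [pd_bogovskiiOperator hη1 hR hf1 hfc i j m x]
      rw [hexp]
      exact ContDiff.sum fun m _ ↦ contDiff_const.mul
        ((ih (hηn m) (hηR m) hfn' hfc i j).add (ih hηn' hR (hfn m) (hfcn m) i j))

/-- **`SV_η f ∈ C^n`** for `η ∈ C^n` vanishing off `B̄_R` and `f ∈ C^n_c`, every `n : ℕ` (induction on `n` with the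
derivative formula `pd_bogovskiiVOperator`). [cite: MaoOhTao2023, Lemma 2.3] -/
theorem contDiff_bogovskiiVOperator (n : ℕ) :
    ∀ {η f : E3 → ℝ} {R : ℝ}, ContDiff ℝ n η → (∀ z : E3, R < ‖z‖ → η z = 0) → ContDiff ℝ n f →
      HasCompactSupport f → ∀ a : Fin 3,
        ContDiff ℝ n fun x : E3 ↦ ∫ y : E3, bogovskiiWeight η y ‖x - y‖ (‖x - y‖⁻¹ • (x - y)) *
          ((x - y) a * (‖x - y‖ ^ 3)⁻¹) * f y := by
  induction n with
  | zero =>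
    intro η f R hη hR hf hfc a
    rw [Nat.cast_zero, contDiff_zero]
    exact continuous_bogovskiiVOperator hη.continuous hR hf.continuous hfc a
  | succ n ih =>
    intro η f R hη hR hf hfc a
    have hη1 : ContDiff ℝ 1 η := hη.of_le (by exact_mod_cast Nat.le_add_left 1 n)
    have hf1 : ContDiff ℝ 1 f := hf.of_le (by exact_mod_cast Nat.le_add_left 1 n)
    have hηn : ∀ m, ContDiff ℝ n (pd m η) := fun m ↦ contDiff_pd (by exact_mod_cast hη) m
    have hfn : ∀ m, ContDiff ℝ n (pd m f) := fun m ↦ contDiff_pd (by exact_mod_cast hf) m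
    have hηR : ∀ m (z : E3), R < ‖z‖ → pd m η z = 0 := fun m z hz ↦ pd_eq_zero_of_norm_lt hR m z hz
    have hfcn : ∀ m, HasCompactSupport (pd m f) := fun m ↦ hasCompactSupport_pd hfc m
    have hηn' : ContDiff ℝ n η := hη.of_le (by exact_mod_cast Nat.le_succ n)
    have hfn' : ContDiff ℝ n f := hf.of_le (by exact_mod_cast Nat.le_succ n)
    rw [show ((↑(n + 1) : ℕ∞ω)) = (n : ℕ∞ω) + 1 by push_cast; rfl, contDiff_succ_iff_fderiv_apply]
    refine ⟨differentiable_bogovskiiVOperator hη1 hR hf1 hfc a, fun h ↦ by simp at h, fun v ↦ ?_⟩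
    · have hexp : (fun x : E3 ↦ fderiv ℝ (fun x : E3 ↦ ∫ y : E3, bogovskiiWeight η y ‖x - y‖
          (‖x - y‖⁻¹ • (x - y)) * ((x - y) a * (‖x - y‖ ^ 3)⁻¹) * f y) x v) =
          fun x ↦ ∑ m, v m * ((∫ y : E3, bogovskiiWeight (pd m η) y ‖x - y‖ (‖x - y‖⁻¹ • (x - y)) *
              ((x - y) a * (‖x - y‖ ^ 3)⁻¹) * f y) +
            ∫ y : E3, bogovskiiWeight η y ‖x - y‖ (‖x - y‖⁻¹ • (x - y)) *
              ((x - y) a * (‖x - y‖ ^ 3)⁻¹) * pd m f y) := by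
        funext x
        rw [fderiv_apply_eq_sum_pd]
        refine Finset.sum_congr rfl fun m _ ↦ ?_
        rw [pd_bogovskiiVOperator hη1 hR hf1 hfc a m x]
      rw [hexp]
      exact ContDiff.sum fun m _ ↦ contDiff_const.mul
        ((ih (hηn m) (hηR m) hfn' hfc a).add (ih hηn' hR (hfn m) (hfcn m) a))

/-- **`S_η f ∈ C^∞` for `C^∞` data** (`η` smooth vanishing off `B̄_R`, e.g. the normalised bump of the star ball,
`f ∈ C_c^∞`). [cite: MaoOhTao2023, Lemma 2.3] -/
theorem contDiff_infty_bogovskiiOperator {η f : E3 → ℝ} {R : ℝ} (hη : ContDiff ℝ ∞ η)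
    (hR : ∀ z : E3, R < ‖z‖ → η z = 0) (hf : ContDiff ℝ ∞ f) (hfc : HasCompactSupport f) (i j : Fin 3) :
    ContDiff ℝ ∞ fun x : E3 ↦ ∫ y : E3, bogovskiiWeight η y ‖x - y‖ (‖x - y‖⁻¹ • (x - y)) *
      ((x - y) i * ((x - y) j * (‖x - y‖ ^ 3)⁻¹)) * f y :=
  contDiff_infty.2 fun n ↦ contDiff_bogovskiiOperator n (hη.of_le (by exact_mod_cast le_top)) hR
    (hf.of_le (by exact_mod_cast le_top)) hfc i j

/-- **`SV_η f ∈ C^∞` for `C^∞` data.** [cite: MaoOhTao2023, Lemma 2.3] -/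
theorem contDiff_infty_bogovskiiVOperator {η f : E3 → ℝ} {R : ℝ} (hη : ContDiff ℝ ∞ η)
    (hR : ∀ z : E3, R < ‖z‖ → η z = 0) (hf : ContDiff ℝ ∞ f) (hfc : HasCompactSupport f) (a : Fin 3) :
    ContDiff ℝ ∞ fun x : E3 ↦ ∫ y : E3, bogovskiiWeight η y ‖x - y‖ (‖x - y‖⁻¹ • (x - y)) *
      ((x - y) a * (‖x - y‖ ^ 3)⁻¹) * f y :=
  contDiff_infty.2 fun n ↦ contDiff_bogovskiiVOperator n (hη.of_le (by exact_mod_cast le_top)) hR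
    (hf.of_le (by exact_mod_cast le_top)) hfc a

end MaoOhTao

end Literature.Geometry.Lorentzian

end
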